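import Summits.AnomalousDissipation.AnomalousDissipation.Theorems.BaireTransferDenseLoudDesignerForcesErgodicModelDerivative
import Summits.AnomalousDissipation.AnomalousDissipation.Theorems.BaireTransferDenseLoudDesignerForcesErgodicConjugatedLinearisedMildIdentity
import Summits.AnomalousDissipation.AnomalousDissipation.Theorems.BaireTransferDenseLoudDesignerForcesErgodicFramePreimage
import Summits.AnomalousDissipation.AnomalousDissipation.Theorems.BaireTransferDenseLoudDesignerForcesErgodicRateTransfer
import Literature.Analysis.UnboundedOperators.LinearisedMildCurve
import Literature.Analysis.FluidPDE.StokesTorusFrameEquivalence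

/-!
# The derivative of the model map is the frame of the linearised Navier–Stokes flow (block N-A, KEY lemmas for the
# tools stub A3 `stub_hyperbolicityTransferTools`, line `ergodic-budget-selection-closing`, crux
# `BaireTransfer.DenseLoudDesignerForces`, stmt-AnomalousDissipation-1143)

Summit-side glue (sorry-free, no definitions) identifying the derivative `D(g t)(y) h` of the model map
`g = F.modelMap ν xF U'` (block N) with the FRAME of classical solutions of the linearised Navier–Stokes equation:

* `ModelFrame.frame_norm_sq_le` — the frame `F.S = (1 + A)^{-1/2}` is an `H → H¹` norm equivalence
  (`Torus.frame_norm_sq_equivalence`): `‖z‖² ≤ 2 (‖F.S z‖² + ‖∇ F.S z‖₂²) ≤ 2 ‖z‖²`;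
* `ModelFrame.fderiv_modelMap_eq_of_linearMild` — UNIQUENESS: any curve `Z`, continuous on `[0, 3]`, solving the linear mild
  identity of S6d₂a along the model orbit of `y ∈ U` from the datum `h` IS `t ↦ D(g t)(y) h`
  (`stub_modelDerivativeTools` + `Literature.Analysis.UnboundedOperators.linearMild_unique`);
* `ModelFrame.fderiv_modelMap_eq_frame_of_classical` — CLOSED WINDOWS: if the model orbit of `y` is the frame curve of a
  field `u` on `[a₀, a₀ + 3]` and `(w, q)` is a classical linearised solution along `u` there with `F.S h = [w a₀]`, then
  `D(g t)(y) h = F.S ([w(a₀ + t)] − [Δ w(a₀ + t)])` (L1 `stub_conjugatedLinearisedMildIdentityTools` + uniqueness);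
* `ModelFrame.fderiv_modelMap_eq_frame_of_tendsto` — ROUGH DATA: the same for a linearised solution classical on `(0, 3]`
  only, attaining the `V`-datum `F.S h` in `L²` and `Ḣ¹` at `0⁺` (the output of L2): the frame curve solves the identity on
  every window `[ε, 3]` (L1), is continuous at `0` in `Hsp` by the frame equivalence, hence solves the identity from `0`
  (`linearMild_of_forall_window`), and uniqueness applies.

References: D. Henry, *Geometric Theory of Semilinear Parabolic Equations*, LNM 840 (1981), Thm. 3.4.4, Cor. 3.4.6,
Lemma 7.1.1; P. Constantin, C. Foias, *Navier–Stokes Equations* (1988), Ch. 13–14.  Nothing is asserted; no definition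
is added.
-/

-- `Summit.<Summit>.<Problem>` is the tree's mandated summit-side namespace (CONVENTIONS §2); for this
-- single-conjunct summit the two coincide, so the duplicate is deliberate.
set_option linter.dupNamespace false

noncomputable section

open Set Function MeasureTheory Filter
open scoped InnerProductSpace Topology ENNReal

namespace Summit.AnomalousDissipation.AnomalousDissipation.Theorems.DenseLoudDesignerForces.Ergodic

open Literature.Analysis.FunctionSpaces Literature.Analysis.FunctionSpaces.Torus
open Literature.Analysis.FluidPDE Literature.Analysis.FluidPDE.Torus
open Literature.Analysis.UnboundedOperators

namespace ModelFrame

/-! ## The frame is an `H → H¹` norm equivalence -/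

/-- The mode basis of a model frame consists of Stokes modes with the recorded eigenvalues (the two conjuncts of
`ModelFrame.hmodes` consumed by the frame-bound files). [folklore] -/
theorem hmodes' (F : ModelFrame) : ∀ i, ∃ (k : Fin 3 → ℤ) (a : EuclideanSpace ℝ (Fin 3)) (c : Bool),
    ((F.b i : Hsp) : Lp (EuclideanSpace ℝ (Fin 3)) 2 (volume : Measure (UnitAddTorus (Fin 3)))) = stokesModeL2 k a c ∧
      F.m i = stokesEigenvalue k := fun i => by
  obtain ⟨k, a, c, -, -, -, h1, h2⟩ := F.hmodes i
  exact ⟨k, a, c, h1, h2⟩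

/-- **The frame `F.S = (1 + A)^{-1/2}` is an `H → H¹` norm equivalence**: for every `z`, `‖∇ (F.S z)‖₂² < ∞`,
`‖F.S z‖² + ‖∇ (F.S z)‖₂² ≤ ‖z‖²` and `‖z‖² ≤ 2 (‖F.S z‖² + ‖∇ (F.S z)‖₂²)` (`Torus.frame_norm_sq_equivalence`;
Constantin–Foias 1988, Ch. 4 (4.11)–(4.13)). [folklore] -/
theorem frame_norm_sq_le (F : ModelFrame) (z : Hsp) :
    eGradNormSq (rep (F.S z)) ≠ ⊤ ∧ ‖F.S z‖ ^ 2 + (eGradNormSq (rep (F.S z))).toReal ≤ ‖z‖ ^ 2 ∧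
      ‖z‖ ^ 2 ≤ 2 * (‖F.S z‖ ^ 2 + (eGradNormSq (rep (F.S z))).toReal) :=
  frame_norm_sq_equivalence F.b F.m F.hmodes' F.S F.hS z

/-! ## Uniqueness: continuous solutions of the linear mild identity are the derivative -/

section Key

variable (F : ModelFrame) {ν : ℝ} (hν : 0 < ν) (xF : Hsp) {U U' : Set Hsp} (hU : IsOpen U) (hU' : IsOpen U') (hUU' : U ⊆ U')
  (htube : ∀ y ∈ U, ∀ t ∈ Icc (0 : ℝ) 3, ∃ (ht : 0 ≤ t) (z : C(Icc (0 : ℝ) t, Hsp)),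
    F.IsMild ν xF ht y z ∧ (∀ r, z r ∈ U') ∧ F.modelMap ν xF U' t y = z ⟨t, ht, le_rfl⟩)
  (hcont : ContinuousOn (fun q : ℝ × Hsp => F.modelMap ν xF U' q.1 q.2) (Icc (0 : ℝ) 3 ×ˢ U))

include hν hU hU' hUU' htube hcont

/-- **Continuous solutions of the linear mild identity along a model orbit ARE the derivative of the model map.**
For `y ∈ U` and a datum `h`, if `Z` is continuous on `[0, 3]` and
`Z t = T(νt) h − ∫₀ᵗ K(ν(t − s)) (Nb (g s y) (Z s) + Nb (Z s) (g s y)) ds` on `[0, 3]`, then `D(g t)(y) h = Z t` there: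
`t ↦ D(g t)(y) h` is another continuous solution (`stub_modelDerivativeTools`), the coefficients
`Nb (g s y) · + Nb · (g s y)` are bounded along the continuous orbit, and continuous solutions of the linear mild equation
are unique (`linearMild_unique`, Henry 1981 Lemma 7.1.1). [folklore] -/
theorem fderiv_modelMap_eq_of_linearMild {y : Hsp} (hy : y ∈ U) (h : Hsp) {Z : ℝ → Hsp}
    (hZc : ContinuousOn Z (Icc 0 3))
    (hZ : ∀ t ∈ Icc (0 : ℝ) 3, Z t = F.T (ν * t) h - ∫ s in (0 : ℝ)..t, F.K (ν * (t - s))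
      (F.Nb (F.modelMap ν xF U' s y) (Z s) + F.Nb (Z s) (F.modelMap ν xF U' s y))) :
    ∀ t ∈ Icc (0 : ℝ) 3, fderiv ℝ (fun y' => F.modelMap ν xF U' t y') y h = Z t := by
  obtain ⟨hDc, hD⟩ := stub_modelDerivativeTools F hν xF hU hU' hUU' htube y hy h
  -- the orbit is continuous on `[0, 3]`
  have hYc : ContinuousOn (fun s : ℝ => F.modelMap ν xF U' s y) (Icc 0 3) :=
    hcont.comp (continuous_id.prodMk continuous_const).continuousOn fun s hs => mk_mem_prod hs hy
  -- uniqueness of continuous solutions of the linearised mild equation along the orbit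
  exact linearisedMild_unique (fun r => F.T (ν * r)) (fun r => F.K (ν * r)) (F.norm_T_mul_le hν.le)
    (α := 3 / 4) (C := ν ^ (-(3 / 4 : ℝ))) (by norm_num) (Real.rpow_nonneg hν.le _) (F.norm_K_mul_le hν)
    (F.continuousOn_K_mul hν) F.Nb (L' := 3) hYc (x := h) hDc hZc hD hZ

/-! ## Closed windows: classical linearised solutions -/

/-- **The derivative along the frame of a CLASSICAL linearised solution.**  Let `y ∈ U` have model orbit
`F.S (g s y) = [u(a₀ + s)]` on `[0, 3]` for a field `u` jointly smooth on `[a₀, a₀ + 3] × T³` with divergence-free mean-zero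
slices, and let `(w, q)` be a classical solution of the linearised equation along `u` on `[a₀, a₀ + 3]` with
`F.S h = [w a₀]`.  Then `D(g t)(y) h = F.S ([w(a₀ + t)] − [Δ w(a₀ + t)])` for `t ∈ [0, 3]`: the frame curve of `w` is
continuous (`ModelFrame.continuousOn_frameCurve`), starts at `h` (`F.S` injective) and solves the linear mild identity
(L1 `stub_conjugatedLinearisedMildIdentityTools`), so `fderiv_modelMap_eq_of_linearMild` applies. [folklore] -/
theorem fderiv_modelMap_eq_frame_of_classical {y : Hsp} (hy : y ∈ U) {a₀ : ℝ}
    {u w : ℝ → (UnitAddTorus (Fin 3)) → (EuclideanSpace ℝ (Fin 3))} {q : ℝ → (UnitAddTorus (Fin 3)) → ℝ}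
    (hu : IsSmoothSpaceTimeOn (Icc a₀ (a₀ + 3)) u) (hudiv : ∀ t ∈ Icc a₀ (a₀ + 3), IsDivFree (u t))
    (humean : ∀ t ∈ Icc a₀ (a₀ + 3), HasZeroMean (u t)) (hlin : IsLinearizedNSSolutionOn (Icc a₀ (a₀ + 3)) ν u w q)
    (horbit : ∀ s ∈ Icc (0 : ℝ) 3, F.S (F.modelMap ν xF U' s y) = stateOf (u (a₀ + s))) {h : Hsp}
    (hh : F.S h = stateOf (w a₀)) :
    ∀ t ∈ Icc (0 : ℝ) 3, fderiv ℝ (fun y' => F.modelMap ν xF U' t y') y h =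
      F.S (stateOf (w (a₀ + t)) - stateOf (laplacian (w (a₀ + t)))) := by
  have h3 : (0 : ℝ) < 3 := zero_lt_three
  have hws : ∀ t ∈ Icc a₀ (a₀ + 3), IsSmooth (w t) := fun t ht => hlin.1.isSmooth_slice ht
  have hI : ∀ s ∈ Icc (0 : ℝ) 3, a₀ + s ∈ Icc a₀ (a₀ + 3) := fun s hs => ⟨by linarith [hs.1], by linarith [hs.2]⟩
  -- the frame curve of `w`
  obtain ⟨Z, hZdef⟩ : ∃ Z : ℝ → Hsp, Z = fun t => F.S (stateOf (w (a₀ + t)) - stateOf (laplacian (w (a₀ + t)))) :=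
    ⟨_, rfl⟩
  have hSZ : ∀ t ∈ Icc (0 : ℝ) 3, F.S (Z t) = stateOf (w (a₀ + t)) := fun t ht => by
    rw [hZdef]
    exact stub_framePreimageTools F.ι F.b F.m F.hmodes F.S F.hS (hws _ (hI t ht)) (hlin.2.2.1 _ (hI t ht))
      (hlin.2.2.2.1 _ (hI t ht))
  have hZ0 : Z 0 = h := F.hSinj (by rw [hSZ 0 (left_mem_Icc.2 h3.le), add_zero, hh])
  have hZc : ContinuousOn Z (Icc 0 3) :=
    F.continuousOn_frameCurve h3 hlin.1 hlin.2.2.1 hlin.2.2.2.1 hSZ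
  have hid := stub_conjugatedLinearisedMildIdentityTools F hν h3 hu hudiv humean hlin
    (fun s => F.modelMap ν xF U' s y) horbit Z hSZ
  rw [hZ0] at hid
  intro t ht
  rw [F.fderiv_modelMap_eq_of_linearMild hν xF hU hU' hUU' htube hcont hy h hZc hid t ht, hZdef]

/-! ## Rough data: linearised solutions classical on `(0, 3]` attaining a `V`-datum -/

/-- **The derivative along the frame of a linearised solution from a ROUGH datum.**  Let `y ∈ U` have model orbit
`F.S (g s y) = [u s]` on `[0, 3]` for `u` jointly smooth on `[0, 3] × T³` with divergence-free mean-zero slices, and let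
`(w, q)` solve the linearised equation along `u` classically on `(0, 3]` with `∫‖w t − rep (F.S h)‖² → 0` and
`‖∇(w t − rep (F.S h))‖₂² → 0` as `t → 0⁺` (the output of L2 `stub_linearisedVDataExistenceTools`).  Then
`D(g t)(y) h = F.S ([w t] − [Δ w t])` for `t ∈ (0, 3]`: the frame curve `Z` of `w`, extended by `h` at `0`, solves the
linear mild identity on every window `[ε, 3]` (L1), is continuous on `(0, 3]` and at `0`
(`‖Z t − h‖² ≤ 2 (∫‖w t − rep (F.S h)‖² + ‖∇(w t − rep (F.S h))‖₂²)`, `ModelFrame.frame_norm_sq_le`), hence solves the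
identity from `0` (`linearMild_of_forall_window`) and is the derivative (`fderiv_modelMap_eq_of_linearMild`)
(Henry 1981, Cor. 3.4.6 with Lemma 3.3.2). [folklore] -/
theorem fderiv_modelMap_eq_frame_of_tendsto {y : Hsp} (hy : y ∈ U)
    {u w : ℝ → (UnitAddTorus (Fin 3)) → (EuclideanSpace ℝ (Fin 3))} {q : ℝ → (UnitAddTorus (Fin 3)) → ℝ}
    (hu : IsSmoothSpaceTimeOn (Icc 0 3) u) (hudiv : ∀ t ∈ Icc (0 : ℝ) 3, IsDivFree (u t))
    (humean : ∀ t ∈ Icc (0 : ℝ) 3, HasZeroMean (u t)) (hlin : IsLinearizedNSSolutionOn (Ioc 0 3) ν u w q)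
    (horbit : ∀ s ∈ Icc (0 : ℝ) 3, F.S (F.modelMap ν xF U' s y) = stateOf (u s)) (h : Hsp)
    (hL2 : Tendsto (fun t => ∫ x, ‖w t x - rep (F.S h) x‖ ^ 2) (𝓝[>] 0) (𝓝 0))
    (hH1 : Tendsto (fun t => eGradNormSq (w t - rep (F.S h))) (𝓝[>] 0) (𝓝 0)) :
    ∀ t ∈ Ioc (0 : ℝ) 3, fderiv ℝ (fun y' => F.modelMap ν xF U' t y') y h =
      F.S (stateOf (w t) - stateOf (laplacian (w t))) := by
  have h3 : (0 : ℝ) < 3 := zero_lt_three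
  have hws : ∀ t ∈ Ioc (0 : ℝ) 3, IsSmooth (w t) := fun t ht => hlin.1.isSmooth_slice ht
  have hwd : ∀ t ∈ Ioc (0 : ℝ) 3, IsDivFree (w t) := hlin.2.2.1
  have hwm : ∀ t ∈ Ioc (0 : ℝ) 3, HasZeroMean (w t) := hlin.2.2.2.1
  -- the candidate: the frame curve of `w`, extended by `h` at (and below) `0`
  obtain ⟨Z, hZdef⟩ : ∃ Z : ℝ → Hsp,
      Z = fun t => if 0 < t then F.S (stateOf (w t) - stateOf (laplacian (w t))) else h := ⟨_, rfl⟩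
  have hZpos : ∀ t : ℝ, 0 < t → Z t = F.S (stateOf (w t) - stateOf (laplacian (w t))) := fun t ht => by
    rw [hZdef]
    exact if_pos ht
  have hZ0 : Z 0 = h := by
    rw [hZdef]
    exact if_neg (lt_irrefl 0)
  have hSZ : ∀ t ∈ Ioc (0 : ℝ) 3, F.S (Z t) = stateOf (w t) := fun t ht => by
    rw [hZpos t ht.1]
    exact stub_framePreimageTools F.ι F.b F.m F.hmodes F.S F.hS (hws t ht) (hwd t ht) (hwm t ht)
  -- the data of the window `[ε, 3] = [ε, ε + (3 - ε)]`
  have hwdata : ∀ ε : ℝ, 0 < ε → ε < 3 →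
      IsSmoothSpaceTimeOn (Icc ε (ε + (3 - ε))) u ∧ (∀ t ∈ Icc ε (ε + (3 - ε)), IsDivFree (u t)) ∧
      (∀ t ∈ Icc ε (ε + (3 - ε)), HasZeroMean (u t)) ∧ IsLinearizedNSSolutionOn (Icc ε (ε + (3 - ε))) ν u w q ∧
      (∀ s ∈ Icc (0 : ℝ) (3 - ε), F.S (F.modelMap ν xF U' (ε + s) y) = stateOf (u (ε + s))) ∧
      ∀ s ∈ Icc (0 : ℝ) (3 - ε), F.S (Z (ε + s)) = stateOf (w (ε + s)) := by
    intro ε hε hε3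
    have he : ε + (3 - ε) = 3 := by ring
    have hsub1 : Icc ε (ε + (3 - ε)) ⊆ Icc 0 3 := by rw [he]; exact Icc_subset_Icc_left hε.le
    have hsub2 : Icc ε (ε + (3 - ε)) ⊆ Ioc 0 3 := by rw [he]; exact Icc_subset_Ioc_left hε
    have hIs : ∀ s ∈ Icc (0 : ℝ) (3 - ε), ε + s ∈ Icc (0 : ℝ) 3 ∧ ε + s ∈ Ioc (0 : ℝ) 3 := fun s hs =>
      ⟨⟨by linarith [hs.1], by linarith [hs.2]⟩, ⟨by linarith [hs.1], by linarith [hs.2]⟩⟩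
    exact ⟨hu.mono hsub1, fun t ht => hudiv t (hsub1 ht), fun t ht => humean t (hsub1 ht),
      hlin.mono hsub2 (uniqueDiffOn_Icc (by linarith)), fun s hs => horbit _ (hIs s hs).1, fun s hs => hSZ _ (hIs s hs).2⟩
  -- (1) the identity on every window (L1)
  have hwin : ∀ ε : ℝ, 0 < ε → ε < 3 → ∀ t ∈ Icc (0 : ℝ) (3 - ε), Z (ε + t) = F.T (ν * t) (Z ε) -
      ∫ s in (0 : ℝ)..t, F.K (ν * (t - s)) (F.Nb (F.modelMap ν xF U' (ε + s) y) (Z (ε + s)) +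
        F.Nb (Z (ε + s)) (F.modelMap ν xF U' (ε + s) y)) := by
    intro ε hε hε3 t ht
    obtain ⟨hu', hudiv', humean', hlin', horbit', hSZ'⟩ := hwdata ε hε hε3
    have h := stub_conjugatedLinearisedMildIdentityTools F hν (by linarith : (0 : ℝ) < 3 - ε) hu' hudiv' humean' hlin'
      (fun s => F.modelMap ν xF U' (ε + s) y) horbit' (fun s => Z (ε + s)) hSZ' t ht
    rwa [add_zero] at h
  -- (2) continuity on `(0, 3]`
  have hZc_pos : ∀ t ∈ Ioc (0 : ℝ) 3, ContinuousWithinAt Z (Icc 0 3) t := by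
    intro t ht
    have hε : 0 < t / 2 := by linarith [ht.1]
    have hε3 : t / 2 < 3 := by linarith [ht.2]
    obtain ⟨hu', hudiv', humean', hlin', -, hSZ'⟩ := hwdata (t / 2) hε hε3
    have hc : ContinuousOn (fun s => Z (t / 2 + s)) (Icc 0 (3 - t / 2)) :=
      F.continuousOn_frameCurve (by linarith) hlin'.1 hlin'.2.2.1 hlin'.2.2.2.1 hSZ'
    have hc' : ContinuousOn Z (Icc (t / 2) 3) := by
      have h1 := hc.comp (continuous_sub_right (t / 2)).continuousOn
        (fun r (hr : r ∈ Icc (t / 2) 3) => ⟨by linarith [hr.1], by linarith [hr.2]⟩)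
      exact h1.congr fun r _ => by simp only [Function.comp_apply, add_sub_cancel]
    have hmem : Icc (t / 2) 3 ∈ 𝓝[Icc 0 3] t := by
      refine mem_nhdsWithin.2 ⟨Ioi (t / 2), isOpen_Ioi, by simp only [mem_Ioi]; linarith [ht.1], ?_⟩
      rintro r ⟨hr1, hr2⟩
      exact ⟨le_of_lt hr1, hr2.2⟩
    exact (hc' t ⟨by linarith [ht.1], ht.2⟩).mono_of_mem_nhdsWithin hmem
  -- (3) continuity at `0`: the frame equivalence
  have hbound : ∀ t ∈ Ioc (0 : ℝ) 3,
      ‖Z t - h‖ ^ 2 ≤ 2 * ((∫ x, ‖w t x - rep (F.S h) x‖ ^ 2) + (eGradNormSq (w t - rep (F.S h))).toReal) := by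
    intro t ht
    obtain ⟨-, -, hle⟩ := F.frame_norm_sq_le (Z t - h)
    have hrep : rep (F.S (Z t - h)) =ᵐ[volume] (w t - rep (F.S h)) := by
      rw [map_sub, hSZ t ht]
      have h1 : rep (stateOf (w t) - F.S h) =ᵐ[volume] fun x => rep (stateOf (w t)) x - rep (F.S h) x := by
        show (((stateOf (w t) - F.S h : Hsp) : Lp (EuclideanSpace ℝ (Fin 3)) 2 (volume : Measure (UnitAddTorus (Fin 3)))) :
            (UnitAddTorus (Fin 3)) → (EuclideanSpace ℝ (Fin 3))) =ᵐ[volume] _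
        rw [Submodule.coe_sub]
        exact Lp.coeFn_sub _ _
      filter_upwards [h1, rep_stateOf (hws t ht) (hwd t ht) (hwm t ht)] with x e1 e2
      rw [e1, e2, Pi.sub_apply]
    rw [stub_trajectoryPowerBudget_aux_norm_sq _ hrep, eGradNormSq_congr_ae hrep] at hle
    simpa only [Pi.sub_apply] using hle
  have hZc0 : ContinuousWithinAt Z (Icc 0 3) 0 := by
    have hT : Tendsto (fun t => 2 * ((∫ x, ‖w t x - rep (F.S h) x‖ ^ 2) + (eGradNormSq (w t - rep (F.S h))).toReal))
        (𝓝[>] 0) (𝓝 0) := by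
      have h2 : Tendsto (fun t => (eGradNormSq (w t - rep (F.S h))).toReal) (𝓝[>] 0) (𝓝 0) := by
        have h := (ENNReal.tendsto_toReal ENNReal.zero_ne_top).comp hH1
        rwa [ENNReal.toReal_zero] at h
      have h := (hL2.add h2).const_mul 2
      rwa [add_zero, mul_zero] at h
    have hsq : Tendsto (fun t => ‖Z t - h‖ ^ 2) (𝓝[>] 0) (𝓝 0) := by
      refine squeeze_zero' (Eventually.of_forall fun t => sq_nonneg _) ?_ hT
      filter_upwards [Ioc_mem_nhdsGT h3] with t ht
      exact hbound t ht
    have hnorm : Tendsto (fun t => ‖Z t - h‖) (𝓝[>] 0) (𝓝 0) := by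
      have h := (Real.continuous_sqrt.tendsto 0).comp hsq
      rw [Real.sqrt_zero] at h
      refine h.congr' (Eventually.of_forall fun t => ?_)
      simp only [Function.comp_apply, Real.sqrt_sq (norm_nonneg _)]
    have hT' : Tendsto Z (𝓝[>] 0) (𝓝 h) := tendsto_iff_norm_sub_tendsto_zero.2 hnorm
    have hIoi : ContinuousWithinAt Z (Ioi 0) 0 := by
      rw [ContinuousWithinAt, hZ0]
      exact hT'
    exact (continuousWithinAt_Ioi_iff_Ici.1 hIoi).mono Icc_subset_Ici_self
  have hZc : ContinuousOn Z (Icc 0 3) := fun t ht =>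
    (eq_or_lt_of_le ht.1).elim (fun h0 => h0 ▸ hZc0) fun h0 => hZc_pos t ⟨h0, ht.2⟩
  -- (4) the identity from `0` (windows + continuity)
  have hYc : ContinuousOn (fun s : ℝ => F.modelMap ν xF U' s y) (Icc 0 3) :=
    hcont.comp (continuous_id.prodMk continuous_const).continuousOn fun s hs => mk_mem_prod hs hy
  have hid := linearisedMild_of_forall_window (fun r => F.T (ν * r)) (fun r => F.K (ν * r)) (F.T_mul_zero ν)
    (F.norm_T_mul_le hν.le) (F.continuous_T_mul ν) (α := 3 / 4) (C := ν ^ (-(3 / 4 : ℝ))) (by norm_num)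
    (F.norm_K_mul_le hν) (F.continuousOn_K_mul hν) F.Nb (τ := 3) hYc hZc hwin
  rw [hZ0] at hid
  -- (5) uniqueness
  intro t ht
  rw [F.fderiv_modelMap_eq_of_linearMild hν xF hU hU' hUU' htube hcont hy h hZc hid t ⟨ht.1.le, ht.2⟩, hZpos t ht.1]

end Key

end ModelFrame

end Summit.AnomalousDissipation.AnomalousDissipation.Theorems.DenseLoudDesignerForces.Ergodic

end
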